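import Literature.NumberTheory.GaloisRepresentations.GlobalArtinMapSecondInequalityProofs
import Literature.NumberTheory.GaloisRepresentations.ArtinCharacterReciprocityProofs
import HarnessLib

/-!
# The Artin map and the norm index of an abstract finite abelian extension `E/K`

Topic `NumberTheory/GaloisRepresentations` (global class field theory); namespace
`Literature.NumberTheory.GaloisRepresentations`.  Proof file: four small definitions (an embedding
`E → K̄`, its image `L₀ ⊆ K̄`, the isomorphisms `E ≃ₐ[K] L₀` and `𝓞 E ≃ₐ[𝓞 K] 𝓞 L₀`) with their API
and instances on `L₀`; everything proved, no named fact (D-0026).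

The reciprocity files `GlobalArtinMapOfCharactersProofs`, `GlobalArtinMapNormProofs`,
`GlobalArtinMapSecondInequalityProofs` construct the Artin map `ψ_{L|K} : 𝕀_K → G(L|K)` and prove
`ker ψ_{L|K} = Kˣ N_{L|K} 𝕀_L`, `[𝕀_K : Kˣ N_{L|K} 𝕀_L] = [L : K]` for the finite abelian subextensions `L`
**of the fixed algebraic closure `K̄`**.  For the existence theorem (Tate, Cassels–Fröhlich VII §12,
induction through towers `K ⊆ K' ⊆ L`) and for consumers holding an abstract extension
(`E : Type`, `Algebra K E`), the same statements are needed for an **abstract** finite abelian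
extension `E/K` of number fields, whose norm group `Kˣ N_{E|K} 𝕀_E` (`Automorphic.normGroup K E`) is
built from the adeles of `E` itself.  This file provides them without transporting adeles: embed
`E` into `K̄` (`L₀ = ` the image, `E ≃ₐ[K] L₀`), keep the **Galois side on `L₀`** (the Artin map
`ψ_{L₀|K}` of the tree) and the **adelic side on `E`**, and rerun the two arguments of the previous
files for the pair `(E, L₀)`:

* **Tate 4.4 for `E`** (`artinIdeleMap_ideleRelNorm_abstract`): `ψ_{L₀|K}(N_{E|K} 𝕀_E) = 1` — for a
  character `χ` of `G(L₀|K)`, the Hecke character `ω_χ ∘ N_{E|K}` of `E` has value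
  `χ(Frob_v)^{e_v f_v} = 1` at almost every uniformizer (`Frob_v^{f_v} = 1` in `G(L₀|K)`, the residue
  degrees of `E` and `L₀ ≅ E` at `v` agree), hence is trivial (rigidity);
* **the norm index** (`index_normGroup_eq_finrank_abstract`): `[𝕀_K : Kˣ N_{E|K} 𝕀_E] = [E : K]` —
  `[E:K] = [L₀:K] = [𝕀_K : ker ψ_{L₀|K}]` divides the index (by 4.4), which divides
  `[ℐ_K(𝔪) : 𝒫⁺𝒩_{E/K}(𝔪)] ≤ [E : K]` (dictionary, admissible modulus and universal norm index inequality,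
  all stated in the tree for an abstract `E`);
* hence **`ker ψ_{L₀|K} = Kˣ N_{E|K} 𝕀_E`** (`ker_artinIdeleMap_embeddedField_eq_normGroup`), the
  corollary **`Kˣ N_{E|K} 𝕀_E = Kˣ N_{L₀|K} 𝕀_{L₀}`** (`normGroup_eq_normGroup_embeddedField`: norm groups
  of `K`-isomorphic extensions coincide — proved through class field theory, not by transporting
  adeles), and the **reciprocity law for an abstract finite abelian extension**
  (`exists_artinMap_of_isAbelianGalois`, unconditional via the tree's
  `artinReciprocity_character_holds`): a surjection `ψ : 𝕀_K → G(E|K)` with open kernel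
  `Kˣ N_{E|K} 𝕀_E`, `ψ(⟨ϖ_v⟩) = Frob_v` and `ψ(⟨𝒪_vˣ⟩) = 1` at the primes unramified in `E`
  (Tate 5.1 (A), (B), 4.2 (iii)); `index_normGroup_eq_finrank_of_isAbelianGalois` (the tree had the
  cyclic case, `Automorphic.index_normGroup_eq_finrank_of_isCyclic`).

Sources: Tate, *Global class field theory*, Cassels–Fröhlich Ch. VII, Cor. 4.4, §5.1 (A)–(B),
§4.2 (iii) (PDF pp. 211–212).  The transports of ramification, residue degrees and Frobenius
elements along `𝓞 E ≅ 𝓞 L₀` (Neukirch, *Algebraic Number Theory* I §9: conjugate primes) use Mathlib's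
`Ideal.ramificationIdx'_comap_eq`, `Ideal.inertiaDeg'_comap_eq`.

## References

* J. Tate, *Global class field theory*, Ch. VII in J. W. S. Cassels, A. Fröhlich (eds.), *Algebraic
  Number Theory*, Academic Press 1967, Cor. 4.4, §4.2 (iii), §5.1 (A)–(B) (PDF pp. 211–212).
  [CasselsFrohlichANT1967]
* J. Neukirch, *Class Field Theory — The Bonn Lectures*, ed. A. Schmidt, Springer 2013, Part III
  (6.13), p. 167. [Neukirch2013]
* J. Neukirch, *Algebraic Number Theory*, Grundlehren 322, Springer 1999, Ch. I §9. [NeukirchANT1999]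
-/

noncomputable section

open scoped NumberField
open NumberField IsDedekindDomain IsDedekindDomain.HeightOneSpectrum Field Filter
open Literature.NumberTheory.Automorphic

namespace Literature.NumberTheory.GaloisRepresentations

/-! ### §1. Transport of ramification data along an isomorphism of rings of integers -/

section Transport

variable {K : Type} [Field K] [NumberField K]
variable {E E' : Type} [Field E] [NumberField E] [Algebra K E] [Field E'] [NumberField E'] [Algebra K E']

/-- **Ramification is invariant under `𝓞_K`-isomorphisms**: if `p ≠ 0` is unramified in `E'` and
`𝓞 E ≃ₐ[𝓞 K] 𝓞 E'`, then `p` is unramified in `E` (ramification indices of corresponding primes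
agree, Mathlib `Ideal.ramificationIdx'_comap_eq`). [cite: NeukirchANT1999, Ch. I §9] -/
theorem isUnramifiedIn_of_algEquiv (f : 𝓞 E ≃ₐ[𝓞 K] 𝓞 E') {p : Ideal (𝓞 K)} (hp : p ≠ ⊥)
    (h : Algebra.IsUnramifiedIn (𝓞 E') p) : Algebra.IsUnramifiedIn (𝓞 E) p := by
  rw [Algebra.isUnramifiedIn_iff_forall_ramificationIdx_eq_one] at h ⊢
  intro P _ hP
  haveI := hP
  haveI : (P.map f).IsPrime := Ideal.map_isPrime_of_equiv f
  have h1 : (P.map f).ramificationIdx (𝓞 K) = 1 := h (P.map f) inferInstance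
  have hcomap : (P.map f).comap f = P := Ideal.comap_map_of_bijective f f.bijective
  rw [← Ideal.ramificationIdx'_eq_ramificationIdx (p := p) (q := P) hp,
    ← Ideal.ramificationIdx'_eq_ramificationIdx (p := p) (q := P.map f) hp] at *
  rw [← h1, ← Ideal.ramificationIdx'_comap_eq (p := p) f (P.map f), hcomap]

/-- **Residue degrees are invariant under `𝓞_K`-isomorphisms** (Galois case): for `E`, `E'` Galois over
`K` with `𝓞 E ≃ₐ[𝓞 K] 𝓞 E'` and a prime `p ≠ 0` of `K`, `f_p(E) = f_p(E')` (`Ideal.inertiaDegIn`).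
[cite: NeukirchANT1999, Ch. I §9] -/
theorem inertiaDegIn_eq_of_algEquiv [IsGalois K E] [IsGalois K E'] (f : 𝓞 E ≃ₐ[𝓞 K] 𝓞 E')
    (v : HeightOneSpectrum (𝓞 K)) :
    v.asIdeal.inertiaDegIn (𝓞 E) = v.asIdeal.inertiaDegIn (𝓞 E') := by
  haveI := v.isMaximal
  haveI : IsGaloisGroup (E ≃ₐ[K] E) (𝓞 K) (𝓞 E) := IsGaloisGroup.of_isFractionRing _ _ _ K E
  haveI : IsGaloisGroup (E' ≃ₐ[K] E') (𝓞 K) (𝓞 E') := IsGaloisGroup.of_isFractionRing _ _ _ K E'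
  obtain ⟨P, hPmax, hPover⟩ :=
    Ideal.exists_maximal_ideal_liesOver_of_isIntegral (S := 𝓞 E) v.asIdeal
  haveI := hPmax
  haveI := hPover
  haveI : (P.map f).IsPrime := Ideal.map_isPrime_of_equiv f
  have hPne : P.map f ≠ ⊥ := Ideal.ne_bot_of_liesOver_of_ne_bot v.ne_bot _
  haveI : (P.map f).IsMaximal := Ideal.IsPrime.isMaximal inferInstance hPne
  rw [Ideal.inertiaDegIn_eq_inertiaDeg v.asIdeal P (E ≃ₐ[K] E),
    Ideal.inertiaDegIn_eq_inertiaDeg v.asIdeal (P.map f) (E' ≃ₐ[K] E'),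
    ← Ideal.inertiaDeg'_eq_inertiaDeg (p := v.asIdeal) (q := P),
    ← Ideal.inertiaDeg'_eq_inertiaDeg (p := v.asIdeal) (q := P.map f),
    ← Ideal.inertiaDeg'_comap_eq (p := v.asIdeal) f (P.map f), Ideal.comap_map_of_bijective f f.bijective]

omit [NumberField K] [NumberField E] [NumberField E'] in
/-- The `𝓞_K`-isomorphism of rings of integers induced by a `K`-isomorphism intertwines the Galois
actions: `(e φ e⁻¹) • f(y) = f(φ • y)` for `f = 𝓞(e)`. [folklore] -/
theorem mapAlgEquiv_galois_smul (e : E ≃ₐ[K] E') (φ : E ≃ₐ[K] E) (y : 𝓞 E) :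
    (e.autCongr φ) • RingOfIntegers.mapAlgEquiv e y = RingOfIntegers.mapAlgEquiv e (φ • y) := by
  apply RingOfIntegers.ext
  rw [RingOfIntegers.coe_galois_smul]
  change (e.autCongr φ) (e (y : E)) = e ((φ • y : 𝓞 E) : E)
  rw [RingOfIntegers.coe_galois_smul]
  change e (φ (e.symm (e (y : E)))) = e (φ (y : E))
  rw [AlgEquiv.symm_apply_apply]

omit [NumberField K] [NumberField E] [NumberField E'] in
/-- **Frobenius elements are transported by `K`-isomorphisms**: if `φ` is an arithmetic Frobenius of
`E` at the prime `Q`, then `e φ e⁻¹` is an arithmetic Frobenius of `E'` at `𝓞(e)(Q)`.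
[cite: NeukirchANT1999, Ch. I §9] -/
theorem isArithFrobAt_autCongr (e : E ≃ₐ[K] E') {Q : Ideal (𝓞 E)} {φ : E ≃ₐ[K] E}
    (hφ : IsArithFrobAt (𝓞 K) φ Q) :
    IsArithFrobAt (𝓞 K) (e.autCongr φ) (Q.map (RingOfIntegers.mapAlgEquiv e)) := by
  have hunder : (Q.map (RingOfIntegers.mapAlgEquiv e)).under (𝓞 K) = Q.under (𝓞 K) :=
    (Ideal.LiesOver.over (P := Q.map (RingOfIntegers.mapAlgEquiv e)) (p := Q.under (𝓞 K))).symm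
  intro y'
  obtain ⟨y, rfl⟩ : ∃ y, RingOfIntegers.mapAlgEquiv e y = y' :=
    ⟨(RingOfIntegers.mapAlgEquiv e).symm y', (RingOfIntegers.mapAlgEquiv e).apply_symm_apply y'⟩
  rw [MulSemiringAction.toAlgHom_apply, hunder, mapAlgEquiv_galois_smul, ← map_pow, ← map_sub]
  apply Ideal.mem_map_of_mem
  have h := hφ y
  rwa [MulSemiringAction.toAlgHom_apply] at h

end Transport

/-! ### §2. The embedded copy `L₀ ⊆ K̄` of an abstract extension `E` -/

section Embedded

variable (K : Type) [Field K] (E : Type) [Field E] [Algebra K E] [FiniteDimensional K E]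

/-- A `K`-embedding of the finite extension `E` into the algebraic closure `K̄`. [folklore] -/
def embeddingToAbs : E →ₐ[K] AlgebraicClosure K :=
  IsAlgClosed.lift

/-- **The embedded copy `L₀ ⊆ K̄` of `E`**: the image of `embeddingToAbs K E`. [folklore] -/
def embeddedField : IntermediateField K (AlgebraicClosure K) :=
  (⊤ : IntermediateField K E).map (embeddingToAbs K E)

/-- **`E ≃ₐ[K] L₀`**, the isomorphism of `E` with its embedded copy. [folklore] -/
def embeddedEquiv : E ≃ₐ[K] embeddedField K E :=
  IntermediateField.topEquiv.symm.trans (IntermediateField.equivMap ⊤ (embeddingToAbs K E))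

/-- `L₀` is finite over `K`. [folklore] -/
instance finiteDimensional_embeddedField : FiniteDimensional K (embeddedField K E) :=
  LinearEquiv.finiteDimensional (embeddedEquiv K E).toLinearEquiv

/-- `[L₀ : K] = [E : K]`. [folklore] -/
theorem finrank_embeddedField : Module.finrank K (embeddedField K E) = Module.finrank K E :=
  (embeddedEquiv K E).toLinearEquiv.finrank_eq.symm

/-- `L₀|K` is abelian if `E|K` is. [folklore] -/
instance isAbelianGalois_embeddedField [IsAbelianGalois K E] : IsAbelianGalois K (embeddedField K E) :=
  IsAbelianGalois.of_algHom (embeddedEquiv K E).symm.toAlgHom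

/-- `L₀|K` is Galois if `E|K` is. [folklore] -/
instance isGalois_embeddedField [IsGalois K E] : IsGalois K (embeddedField K E) :=
  IsGalois.of_algEquiv (embeddedEquiv K E)

/-- `L₀` is a number field if `K` is. [folklore] -/
instance numberField_embeddedField [NumberField K] : NumberField (embeddedField K E) :=
  NumberField.of_module_finite K _

variable [NumberField K] [NumberField E]

/-- The isomorphism of rings of integers `𝓞 E ≃ₐ[𝓞 K] 𝓞 L₀` induced by `embeddedEquiv`. [folklore] -/
abbrev embeddedIntEquiv : 𝓞 E ≃ₐ[𝓞 K] 𝓞 (embeddedField K E) :=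
  RingOfIntegers.mapAlgEquiv (embeddedEquiv K E)

variable {K E}

/-- `v` is unramified in `L₀` iff it is unramified in `E`. [cite: NeukirchANT1999, Ch. I §9] -/
theorem isUnramifiedIn_embeddedField_iff (v : HeightOneSpectrum (𝓞 K)) :
    Algebra.IsUnramifiedIn (𝓞 (embeddedField K E)) v.asIdeal ↔ Algebra.IsUnramifiedIn (𝓞 E) v.asIdeal :=
  ⟨isUnramifiedIn_of_algEquiv (embeddedIntEquiv K E) v.ne_bot,
    isUnramifiedIn_of_algEquiv (embeddedIntEquiv K E).symm v.ne_bot⟩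

/-- `f_v(L₀) = f_v(E)` for `E|K` Galois. [cite: NeukirchANT1999, Ch. I §9] -/
theorem inertiaDegIn_embeddedField_eq [IsGalois K E] (v : HeightOneSpectrum (𝓞 K)) :
    v.asIdeal.inertiaDegIn (𝓞 (embeddedField K E)) = v.asIdeal.inertiaDegIn (𝓞 E) :=
  (inertiaDegIn_eq_of_algEquiv (embeddedIntEquiv K E) v).symm

/-- **The Frobenius of `L₀` is the transport of the Frobenius of `E`**: for `E|K` abelian and `v`
unramified in `E`, `Frob_v(L₀) = e ∘ Frob_v(E) ∘ e⁻¹`. [cite: NeukirchANT1999, Ch. I §9] -/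
theorem galFrob_embeddedField_eq [IsAbelianGalois K E] {v : HeightOneSpectrum (𝓞 K)}
    (hunr : Algebra.IsUnramifiedIn (𝓞 E) v.asIdeal) :
    galFrob K (embeddedField K E) v = (embeddedEquiv K E).autCongr (galFrob K E v) := by
  obtain ⟨Q, hQ, hφ⟩ := galFrob_spec K E v
  haveI := hQ.1
  haveI := hQ.2
  haveI : (Q.map (embeddedIntEquiv K E)).IsPrime := Ideal.map_isPrime_of_equiv (embeddedIntEquiv K E)
  have hQ' : Q.map (embeddedIntEquiv K E) ∈ v.asIdeal.primesOver (𝓞 (embeddedField K E)) :=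
    ⟨inferInstance, inferInstance⟩
  have hφ' := isArithFrobAt_autCongr (embeddedEquiv K E) hφ
  have hunr' : Algebra.IsUnramifiedIn (𝓞 (embeddedField K E)) v.asIdeal :=
    (isUnramifiedIn_embeddedField_iff v).mpr hunr
  exact (eq_galFrob (commute_of_isAbelianGalois (embeddedField K E)) hunr' hQ' hφ').symm

end Embedded

/-! ### §3. Tate 4.4 for the abstract `E`: `ψ_{L₀|K}` kills `N_{E|K} 𝕀_E` -/

section Norms

variable (K : Type) [Field K] [NumberField K]
variable (E : Type) [Field E] [NumberField E] [Algebra K E] [FiniteDimensional K E] [IsAbelianGalois K E]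

/-- **`ω_χ ∘ N_{E|K} = 1`** for every character `χ` of `G(L₀|K)`: the base change to `E` of the Hecke
character `ω_χ` of `K` is trivial — at a place `w` of `E` above a prime `v` unramified in `E` its value
at `ϖ_w` is `χ(Frob_v)^{e_v f_v} = 1` (`f_v(E) = f_v(L₀)` and `Frob_v^{f_v} = 1` in `G(L₀|K)`).
[cite: CasselsFrohlichANT1967, Ch. VII Cor. 4.4 (PDF p. 212)] -/
theorem charHecke_compRelNorm_abstract_eq_one (hR : artinReciprocity_character)
    (χ : (embeddedField K E ≃ₐ[K] embeddedField K E) →* ℂˣ) :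
    (charHecke (embeddedField K E) χ hR).compRelNorm E = 1 := by
  refine HeckeCharacter.eq_one_of_eventually_valueAtUniformizer_eq_one ?_
  have hev : ∀ᶠ w : HeightOneSpectrum (𝓞 E) in cofinite,
      Algebra.IsUnramifiedIn (𝓞 E) (w.under (𝓞 K)).asIdeal :=
    (HeightOneSpectrum.tendsto_under_cofinite (𝓞 K) (B := 𝓞 E)).eventually
      (by rw [eventually_cofinite]; exact finite_setOf_not_isUnramifiedIn K E)
  filter_upwards [hev] with w hunr
  have hunr₀ : Algebra.IsUnramifiedIn (𝓞 (embeddedField K E)) (w.under (𝓞 K)).asIdeal :=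
    (isUnramifiedIn_embeddedField_iff _).mpr hunr
  rw [(charHecke (embeddedField K E) χ hR).compRelNorm_valueAtUniformizer rfl hunr
    (charHecke_isUnramifiedAt (embeddedField K E) χ hR hunr₀)]
  have hval : (((charHecke (embeddedField K E) χ hR) (localUnits (w.under (𝓞 K))
      (HeckeCharacter.uniformizer K (w.under (𝓞 K)))) : ℂˣ) : ℂ) =
      ((χ (galFrob K (embeddedField K E) (w.under (𝓞 K))) : ℂˣ) : ℂ) := by
    rw [← charHecke_valueAtUniformizer (embeddedField K E) χ hR hunr₀]
    rfl
  rw [hval, ← Units.val_pow_eq_pow_val, ← map_pow, ← inertiaDegIn_embeddedField_eq, pow_mul',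
    galFrob_pow_inertiaDegIn (embeddedField K E) hunr₀, one_pow, map_one, Units.val_one]

/-- **Tate 4.4 for the abstract `E`: `ψ_{L₀|K}(N_{E|K} 𝕀_E) = 1`.**
[cite: CasselsFrohlichANT1967, Ch. VII Cor. 4.4 (PDF p. 212)] -/
theorem artinIdeleMap_ideleRelNorm_abstract (hR : artinReciprocity_character) (y : ideleGroup E) :
    artinIdeleMap (embeddedField K E) hR (AdeleRing.ideleRelNorm K E y) = 1 :=
  algEquiv_eq_of_forall_character (embeddedField K E) fun χ => by
    rw [apply_artinIdeleMap, map_one, ← HeckeCharacter.compRelNorm_apply,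
      charHecke_compRelNorm_abstract_eq_one K E hR χ, HeckeCharacter.one_apply]

/-- **`Kˣ N_{E|K} 𝕀_E ≤ ker ψ_{L₀|K}`.** [cite: CasselsFrohlichANT1967, Ch. VII Cor. 4.4 (PDF p. 212)] -/
theorem normGroup_abstract_le_ker (hR : artinReciprocity_character) :
    Automorphic.normGroup K E ≤ (artinIdeleMap (embeddedField K E) hR).ker := by
  rw [normGroup_eq_sup_range_ideleRelNorm]
  refine sup_le (principalIdeles_le_ker_artinIdeleMap (embeddedField K E) hR) ?_
  rintro _ ⟨y, rfl⟩
  exact (MonoidHom.mem_ker).mpr (artinIdeleMap_ideleRelNorm_abstract K E hR y)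

/-! ### §4. The norm index and the kernel -/

omit [NumberField E] in
/-- `[𝕀_K : ker ψ_{L₀|K}] = [E : K]`. [folklore] -/
theorem index_ker_artinIdeleMap_embeddedField (hR : artinReciprocity_character) :
    (artinIdeleMap (embeddedField K E) hR).ker.index = Module.finrank K E := by
  rw [Subgroup.index_ker, MonoidHom.range_eq_top.mpr (artinIdeleMap_surjective (embeddedField K E) hR),
    Subgroup.card_top, ← finrank_embeddedField K E]
  exact IsGalois.card_aut_eq_finrank K (embeddedField K E)

/-- **`[E : K] ∣ [𝕀_K : Kˣ N_{E|K} 𝕀_E]`** for the abstract abelian `E`.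
[cite: CasselsFrohlichANT1967, Ch. VII Consequence 9.4 (PDF p. 224)] -/
theorem finrank_dvd_index_normGroup_abstract (hR : artinReciprocity_character) :
    Module.finrank K E ∣ (Automorphic.normGroup K E).index := by
  rw [← index_ker_artinIdeleMap_embeddedField K E hR]
  exact Subgroup.index_dvd_of_le (normGroup_abstract_le_ker K E hR)

/-- **`[𝕀_K : Kˣ N_{E|K} 𝕀_E] = [E : K]`** for every finite abelian extension `E/K` of number fields
(abstract `E : Type`), granted `artinReciprocity_character`: `[E:K] ∣ index` (above) and
`index ∣ [ℐ_K(𝔪) : 𝒫⁺𝒩_{E/K}(𝔪)] ≤ [E:K]` for the admissible modulus `𝔪` (dictionary and universal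
norm index inequality of the tree, stated for abstract `E`).
[cite: CasselsFrohlichANT1967, Ch. VII §5.1 Main Theorem (B) (PDF p. 212)] -/
theorem index_normGroup_eq_finrank_abstract (hR : artinReciprocity_character) :
    (Automorphic.normGroup K E).index = Module.finrank K E := by
  set 𝔪 : Ideal (𝓞 K) := IdeleHerbrand.admissibleModulus K E
  have h𝔪 : 𝔪 ≠ ⊥ := IdeleHerbrand.admissibleModulus_ne_bot K E
  have hW : congruenceIdeles 𝔪 ⊓ unitIdeles K ≤ Automorphic.normGroup K E :=
    IdeleHerbrand.congruenceIdeles_inf_unitIdeles_le_normGroup K E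
  have hFrob : ∀ 𝔮 : HeightOneSpectrum (𝓞 K), ¬ 𝔪 ≤ 𝔮.asIdeal →
      ∀ Q ∈ 𝔮.asIdeal.primesOver (𝓞 E),
        localUnits 𝔮 (HeckeCharacter.uniformizer K 𝔮) ^ Q.inertiaDeg (𝓞 K) ∈ Automorphic.normGroup K E :=
    fun 𝔮 h𝔮 Q hQ => localUnits_uniformizer_pow_inertiaDeg_mem_normGroup K E
      (not_not.mp ((IdeleHerbrand.admissibleModulus_le_iff (F := K) (E := E) 𝔮).not.mp h𝔮)) hQ
  have hdvd : (Automorphic.normGroup K E).index ∣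
      (ray 𝔪 ⊔ normSubgroup 𝔪 E).relIndex (idealsPrimeTo 𝔪) :=
    index_normGroup_dvd_relIndex_ray_sup_normSubgroup h𝔪 hW hFrob
  have hle : (ray 𝔪 ⊔ normSubgroup 𝔪 E).relIndex (idealsPrimeTo 𝔪) ≤ Module.finrank K E :=
    relIndex_ray_sup_normSubgroup_le_finrank h𝔪 E
  have hmine : Module.finrank K E ∣ (Automorphic.normGroup K E).index :=
    finrank_dvd_index_normGroup_abstract K E hR
  have hrel0 : (ray 𝔪 ⊔ normSubgroup 𝔪 E).relIndex (idealsPrimeTo 𝔪) ≠ 0 := by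
    haveI : Finite (RayClassGroup 𝔪) := finite_rayClassGroup h𝔪
    have hray0 : (ray 𝔪).relIndex (idealsPrimeTo 𝔪) ≠ 0 := Subgroup.index_ne_zero_of_finite
    exact fun h0 => hray0 (Subgroup.relIndex_eq_zero_of_le_left
      (le_sup_left : ray 𝔪 ≤ ray 𝔪 ⊔ normSubgroup 𝔪 E) h0)
  have hidx0 : (Automorphic.normGroup K E).index ≠ 0 := fun h0 => hrel0 (Nat.eq_zero_of_zero_dvd (h0 ▸ hdvd))
  refine le_antisymm ((Nat.le_of_dvd (Nat.pos_of_ne_zero hrel0) hdvd).trans hle) ?_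
  exact Nat.le_of_dvd (Nat.pos_of_ne_zero hidx0) hmine

/-- **`ker ψ_{L₀|K} = Kˣ N_{E|K} 𝕀_E`**: the kernel of the Artin map of the embedded copy is the norm group
of the abstract `E` (Tate 5.1 (B) for `E`; containment by 4.4 and equality of the finite indices).
[cite: CasselsFrohlichANT1967, Ch. VII §5.1 Main Theorem (B) (PDF p. 212)] -/
theorem ker_artinIdeleMap_embeddedField_eq_normGroup (hR : artinReciprocity_character) :
    (artinIdeleMap (embeddedField K E) hR).ker = Automorphic.normGroup K E := by
  have hle := normGroup_abstract_le_ker K E hR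
  have hidx : (artinIdeleMap (embeddedField K E) hR).ker.index = (Automorphic.normGroup K E).index := by
    rw [index_ker_artinIdeleMap_embeddedField K E hR, index_normGroup_eq_finrank_abstract K E hR]
  have hker0 : (artinIdeleMap (embeddedField K E) hR).ker.index ≠ 0 := by
    rw [index_ker_artinIdeleMap_embeddedField K E hR]
    exact Module.finrank_pos.ne'
  have hrel := Subgroup.relIndex_mul_index hle
  rw [← hidx] at hrel
  have hone : (Automorphic.normGroup K E).relIndex (artinIdeleMap (embeddedField K E) hR).ker = 1 :=
    (mul_left_eq_self₀.mp hrel).resolve_right hker0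
  exact le_antisymm (Subgroup.relIndex_eq_one.mp hone) hle

/-- `ker ψ_{L|K} = Kˣ N_{L|K} 𝕀_L` on the idele group, for a finite abelian `L ⊆ K̄` (idelic form of
`ker_artinClassMap_eq_normClassGroup'`). [cite: CasselsFrohlichANT1967, Ch. VII §5.1 Main Theorem (B) (PDF p. 212)] -/
theorem ker_artinIdeleMap_eq_normGroup_of_character (hR : artinReciprocity_character)
    (L : IntermediateField K (AlgebraicClosure K)) [FiniteDimensional K L] [NumberField L] [IsAbelianGalois K L] :
    (artinIdeleMap L hR).ker = Automorphic.normGroup K L := by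
  have h := ker_artinClassMap_eq_normClassGroup' L hR
  rw [← comap_mk'_normClassGroup K L, ← h]
  ext x
  rw [MonoidHom.mem_ker, Subgroup.mem_comap, MonoidHom.mem_ker, QuotientGroup.mk'_apply,
    artinClassMap_mk]

/-- **Norm groups of `K`-isomorphic extensions coincide: `Kˣ N_{E|K} 𝕀_E = Kˣ N_{L₀|K} 𝕀_{L₀}`** (both are
the kernel of `ψ_{L₀|K}`). [cite: CasselsFrohlichANT1967, Ch. VII §5.1 Main Theorem (B) (PDF p. 212)] -/
theorem normGroup_eq_normGroup_embeddedField (hR : artinReciprocity_character) :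
    Automorphic.normGroup K E = Automorphic.normGroup K (embeddedField K E) :=
  (ker_artinIdeleMap_embeddedField_eq_normGroup K E hR).symm.trans
    (ker_artinIdeleMap_eq_normGroup_of_character K hR (embeddedField K E))

/-! ### §5. The reciprocity law for an abstract finite abelian extension -/

/-- **The Artin map of an abstract finite abelian extension `E/K`**: `ψ_{E|K} = e⁻¹ ∘ ψ_{L₀|K} ∘ …`, the
Artin map of the embedded copy `L₀` transported to `G(E|K)` along `E ≃ₐ[K] L₀`.
[cite: CasselsFrohlichANT1967, Ch. VII §4.2 Corollary (PDF p. 211)] -/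
def artinIdeleMapOfAlgebra (hR : artinReciprocity_character) : ideleGroup K →* (E ≃ₐ[K] E) :=
  ((embeddedEquiv K E).autCongr.symm.toMonoidHom).comp (artinIdeleMap (embeddedField K E) hR)

omit [NumberField E] in
/-- Unfolding lemma for `artinIdeleMapOfAlgebra`. [folklore] -/
theorem autCongr_artinIdeleMapOfAlgebra (hR : artinReciprocity_character) (x : ideleGroup K) :
    (embeddedEquiv K E).autCongr (artinIdeleMapOfAlgebra K E hR x) = artinIdeleMap (embeddedField K E) hR x := by
  change (embeddedEquiv K E).autCongr ((embeddedEquiv K E).autCongr.symm _) = _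
  rw [MulEquiv.apply_symm_apply]

omit [NumberField E] in
/-- `ψ_{E|K}` is surjective. [cite: CasselsFrohlichANT1967, Ch. VII §5.1 Main Theorem (B) (PDF p. 212)] -/
theorem artinIdeleMapOfAlgebra_surjective (hR : artinReciprocity_character) :
    Function.Surjective (artinIdeleMapOfAlgebra K E hR) :=
  (embeddedEquiv K E).autCongr.symm.surjective.comp (artinIdeleMap_surjective (embeddedField K E) hR)

/-- **`ker ψ_{E|K} = Kˣ N_{E|K} 𝕀_E`.** [cite: CasselsFrohlichANT1967, Ch. VII §5.1 Main Theorem (B) (PDF p. 212)] -/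
theorem ker_artinIdeleMapOfAlgebra (hR : artinReciprocity_character) :
    (artinIdeleMapOfAlgebra K E hR).ker = Automorphic.normGroup K E := by
  rw [← ker_artinIdeleMap_embeddedField_eq_normGroup K E hR]
  ext x
  rw [MonoidHom.mem_ker, MonoidHom.mem_ker, ← autCongr_artinIdeleMapOfAlgebra K E hR x,
    MulEquiv.map_eq_one_iff]

/-- `ker ψ_{E|K}` is open. [cite: CasselsFrohlichANT1967, Ch. VII §4.2 Corollary (i) (PDF p. 211)] -/
theorem isOpen_ker_artinIdeleMapOfAlgebra (hR : artinReciprocity_character) :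
    IsOpen ((artinIdeleMapOfAlgebra K E hR).ker : Set (ideleGroup K)) := by
  have h : ((artinIdeleMapOfAlgebra K E hR).ker : Set (ideleGroup K)) =
      ((artinIdeleMap (embeddedField K E) hR).ker : Set (ideleGroup K)) := by
    rw [ker_artinIdeleMapOfAlgebra K E hR, ker_artinIdeleMap_embeddedField_eq_normGroup K E hR]
  rw [h]
  exact isOpen_ker_artinIdeleMap (embeddedField K E) hR

/-- **`ψ_{E|K}(⟨ϖ_v⟩) = Frob_v` and `ψ_{E|K}(⟨𝒪_vˣ⟩) = 1`** at every prime `v` unramified in `E`.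
[cite: CasselsFrohlichANT1967, Ch. VII §4.2 Corollary (iii) (PDF p. 211)] -/
theorem artinIdeleMapOfAlgebra_frobenius (hR : artinReciprocity_character) {v : HeightOneSpectrum (𝓞 K)}
    (hunr : Algebra.IsUnramifiedIn (𝓞 E) v.asIdeal) :
    artinIdeleMapOfAlgebra K E hR (localUnits v (HeckeCharacter.uniformizer K v)) = galFrob K E v ∧
      ∀ u : (v.adicCompletionIntegers K)ˣ,
        artinIdeleMapOfAlgebra K E hR
          (localUnits v (Units.map ((v.adicCompletionIntegers K).subtype : _ →* _) u)) = 1 := by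
  have hunr' : Algebra.IsUnramifiedIn (𝓞 (embeddedField K E)) v.asIdeal :=
    (isUnramifiedIn_embeddedField_iff v).mpr hunr
  constructor
  · apply (embeddedEquiv K E).autCongr.injective
    rw [autCongr_artinIdeleMapOfAlgebra, artinIdeleMap_localUnits_uniformizer _ hR hunr',
      galFrob_embeddedField_eq hunr]
  · intro u
    apply (embeddedEquiv K E).autCongr.injective
    rw [autCongr_artinIdeleMapOfAlgebra, artinIdeleMap_localUnits_integer _ hR hunr' u, map_one]

/-- **The reciprocity law for an abstract finite abelian extension of number fields** (Tate 5.1 (A),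
(B), 4.2 (iii)), unconditionally for `K E : Type`: there is a surjective homomorphism
`ψ : 𝕀_K → G(E|K)` with open kernel `Kˣ N_{E|K} 𝕀_E` (`Automorphic.normGroup K E`) such that
`ψ(⟨ϖ_v⟩) = Frob_v` and `ψ(⟨𝒪_vˣ⟩) = 1` at every prime `v` of `K` unramified in `E`.
[cite: CasselsFrohlichANT1967, Ch. VII §5.1 Main Theorem (A)–(B) and §4.2 Corollary (PDF pp. 211–212)] -/
theorem exists_artinMap_of_isAbelianGalois :
    ∃ ψ : ideleGroup K →* (E ≃ₐ[K] E),
      Function.Surjective ψ ∧ IsOpen (ψ.ker : Set (ideleGroup K)) ∧ ψ.ker = Automorphic.normGroup K E ∧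
      ∀ v : HeightOneSpectrum (𝓞 K), Algebra.IsUnramifiedIn (𝓞 E) v.asIdeal →
        ψ (localUnits v (HeckeCharacter.uniformizer K v)) = galFrob K E v ∧
        ∀ u : (v.adicCompletionIntegers K)ˣ,
          ψ (localUnits v (Units.map ((v.adicCompletionIntegers K).subtype : _ →* _) u)) = 1 :=
  ⟨artinIdeleMapOfAlgebra K E artinReciprocity_character_holds,
    artinIdeleMapOfAlgebra_surjective K E _, isOpen_ker_artinIdeleMapOfAlgebra K E _,
    ker_artinIdeleMapOfAlgebra K E _, fun _ hv => artinIdeleMapOfAlgebra_frobenius K E _ hv⟩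

/-- **`[𝕀_K : Kˣ N_{E|K} 𝕀_E] = [E : K]`** for every finite abelian extension `E/K` of number fields
(`K E : Type`), unconditionally (the cyclic case is the tree's
`Automorphic.index_normGroup_eq_finrank_of_isCyclic`).
[cite: CasselsFrohlichANT1967, Ch. VII §5.1 Main Theorem (B) (PDF p. 212)] -/
theorem index_normGroup_eq_finrank_of_isAbelianGalois :
    (Automorphic.normGroup K E).index = Module.finrank K E :=
  index_normGroup_eq_finrank_abstract K E artinReciprocity_character_holds

/-- **The norm group of a finite abelian extension is open** (`K E : Type`).
[cite: Neukirch2013, Part III §7 Thm. (7.8), p. 178] -/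
theorem isOpen_normGroup_of_isAbelianGalois :
    IsOpen (Automorphic.normGroup K E : Set (ideleGroup K)) := by
  rw [← ker_artinIdeleMapOfAlgebra K E artinReciprocity_character_holds]
  exact isOpen_ker_artinIdeleMapOfAlgebra K E _

end Norms

end Literature.NumberTheory.GaloisRepresentations

end
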